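import Summits.BirchSwinnertonDyer.BirchSwinnertonDyer.Theorems.ErratumRoadFiveEulerHalfNotRamNoInertSetOfAuxNorm
import Summits.BirchSwinnertonDyer.BirchSwinnertonDyer.Theorems.ErratumRoadFiveAuxNormTateComponentFamily
import Summits.BirchSwinnertonDyer.BirchSwinnertonDyer.Theorems.ErratumRoadFiveAuxPrimeChebotarevKummerSupply
import Summits.BirchSwinnertonDyer.BirchSwinnertonDyer.Theorems.ErratumRoadFiveAuxPrimeSplitPrimeKummerWitness
import HarnessLib

/-!
# Route `ErratumRoadFive` (K2, `p ≥ 5`), crux `EulerHalfNotRamNoInertSetAtFive` (item stmt-BirchSwinnertonDyer-19715), line `birth` v15 → v16: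
# THE CLOSER MODULO SEVEN ROUTE ITEMS — every leaf of the auxiliary-norm lever is a tree theorem
# (cell `bsd-stepL`, LEAD `bsd-line-er5-p1` g3; `--workitem stmt-BirchSwinnertonDyer-19715`)

WHY. Skeleton v15 closes the crux modulo SEVEN route items + THREE print-sized registered stubs (S1-lin, (C), (O)); within the same afternoon the
width seats landed all three with the registered headers: S1-lin `TateComponent.stub_tateComponentFamilyLinear` (-w3 g6: Tate normal form component hom
over `K̄_v` p642730, local character p643753, global→local p644863 ∕ p645245 ∕ p645702, assembly), (C) `Theorems.stub_chebotarevKummerSupply` (-w2 g5: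
prime-conductor order p640886, Chebotarev step p641931, trace candidates p642884, Frobenius witness p643339, Kummer element p643849, Kummer descent p644493,
S3♭ assembly p645521) and (O) `Theorems.stub_splitPrimeKummerWitness` (-w2 g5 over the same S3♭ assembly; -w4 g8's Literature
`RingClass.exists_splitPrimeKummerWitness` p645453 ∕ p645872 is the W-free twin), S2♭ being -w4 g8's p642411 ∕ p644744. This file plugs them into the
LEAD's closer `EulerHalfAuxNorm.eulerHalfNotRamNoInertSetAtFive_of_items_of_threeLeaves`: **the crux BY NAME from the seven route items
`PublishedInputsFive` (19066), `X11aLowerHalf` (19064), `ShimuraParametrizationDataNonempty` (19524), `PastenComponentOrdersInput` (19716),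
`ShimuraCasselsTateLevelInputs` (20191), `ShimuraHeegnerEulerSystemInertPrintedR` (20442), `EulerHalfGrossPrintFacts` (27981) and NOTHING ELSE** — no stub,
no beyond-print input; item 27982 `ShimuraCarrierLabelsB6FromFive` is not a binder (it stays on the route for the non-surjective corner 19065 only).

HONEST FRAMING: ONE THEOREM, sorry-free, CONDITIONAL on the seven items (19064 is itself an open crux; the other six are published inputs typed as named
facts ∕ cite-only Literature defs). The ledger status of 19715 stays `open` (statement-close is exact-match only); the node is displayed closed modulo its
seven item leaves. No census number moves (404 = 69 + 334 + 1 + 0); BSD is proved for no curve; no summit statement is touched.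
[cite: GrossLMS1991, §3 Prop. 3.7, §6 proof of Prop. 6.2 (1) (p. 245)] [cite: Jetchev2008, Thm. 1.1, Thm. 1.4, Cor. 1.5] [cite: PastenShimura2024, Prop. 6.13, Lemma 6.18]
[cite: SilvermanATAEC1994, IV Cor. 9.2 (d), V Thm. 3.1] [cite: Cox2013, §7.D Thm. 7.24, Thm. 8.12, §9.A] [cite: Serre1972, §4.4 Lemme 3] [cite: CaiShuTian2014, Thm. 1.5]
-/

set_option autoImplicit false
set_option linter.dupNamespace false -- `Summit.BirchSwinnertonDyer.BirchSwinnertonDyer` (summit = problem), tree-wide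

noncomputable section

namespace Summit.BirchSwinnertonDyer.BirchSwinnertonDyer.Theorems

open Summit.BirchSwinnertonDyer.BirchSwinnertonDyer.Theses.ErratumRoadFive

/-- **Crux 19715 `EulerHalfNotRamNoInertSetAtFive` MODULO SEVEN ROUTE ITEMS (line `birth` v16; the auxiliary-norm lever fully in the kernel).** For every X11b pair
`(E, p)` with `p ≥ 5`, `ρ̄_{E,p}` onto, no (ram) prime, `p ∣ ∏ c_ℓ` and no inert-set datum: `Typed.MissingUpperBoundAt E p` — GIVEN the route items
`PublishedInputsFive`, `X11aLowerHalf`, `ShimuraParametrizationDataNonempty`, `PastenComponentOrdersInput`, `ShimuraCasselsTateLevelInputs`,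
`ShimuraHeegnerEulerSystemInertPrintedR`, `EulerHalfGrossPrintFacts`. := the LEAD's `EulerHalfAuxNorm.eulerHalfNotRamNoInertSetAtFive_of_items_of_threeLeaves` with
S1-lin ∕ (C) ∕ (O) := the width seats' tree theorems `TateComponent.stub_tateComponentFamilyLinear` ∕ `Theorems.stub_chebotarevKummerSupply` ∕
`Theorems.stub_splitPrimeKummerWitness`. CONDITIONAL on the seven items; BSD is proved for no curve.
[cite: GrossLMS1991, §6 p. 245] [cite: Jetchev2008, Thm. 1.4, Cor. 1.5] [cite: PastenShimura2024, Lemma 6.18, Prop. 6.13] [cite: Cox2013, Thm. 8.12, §9.A] -/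
theorem eulerHalfNotRamNoInertSetAtFive_of_sevenItems
    (h₅ : PublishedInputsFive) (h₃ : X11aLowerHalf) (hJL : ShimuraParametrizationDataNonempty)
    (hCO : PastenComponentOrdersInput) (hCTi : ShimuraCasselsTateLevelInputs)
    (hESi : ShimuraHeegnerEulerSystemInertPrintedR) (hF2 : EulerHalfGrossPrintFacts) :
    EulerHalfNotRamNoInertSetAtFive :=
  EulerHalfAuxNorm.eulerHalfNotRamNoInertSetAtFive_of_items_of_threeLeaves h₅ h₃ hJL hCO hCTi hESi hF2
    (fun W _ _ K _ _ ι _ hK q _ hs hq2 ↦ TateComponent.stub_tateComponentFamilyLinear W K ι hK q hs hq2)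
    (fun W _ _ K _ _ hK hdK p _ hp5 hsurj ↦ stub_chebotarevKummerSupply W K hK hdK p hp5 hsurj)
    (fun K _ _ hK hdK p _ hp3 q _ hq2 ↦ stub_splitPrimeKummerWitness K hK hdK p hp3 q hq2)

end Summit.BirchSwinnertonDyer.BirchSwinnertonDyer.Theorems

end
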